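import Mathlib
import HarnessLib

/-!
# Monomial characters of the CM similitude torus `{z : z_i z_ī = ν}`

Pure algebra over a field `K` of characteristic zero (Mathlib only). Let `ι` be a finite set with a
fixed-point-free involution `i ↦ ī` ("complex conjugation") and `n : ι → ℕ` a vector of
exponents. On the torus

  `T̃ = {(z, ν) ∈ (Kˣ)^ι × Kˣ | z_i · z_ī = ν for all i}`

the monomial character `(z, ν) ↦ ∏_i z_i ^ n_i` coincides with the power `ν ^ p` of the
similitude character iff the exponents are **conjugation-balanced of total degree `2p`**:

  `(∀ i, n_i = n_ī) ∧ Σ_i n_i = 2p`              (`CMTorusChar.prod_pow_eq_pow_iff_balanced`).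

"Balanced ⟹ trivial" splits `ι = S ⊔ S̄` along a half-system `S` (`exists_halfSystem`) and pairs
`z_i^{n_i} z_ī^{n_ī} = ν^{n_i}`; "trivial ⟹ balanced" evaluates at the two test points
`z = (2 at i₀, 2⁻¹ at ī₀, 1 elsewhere), ν = 1` and `z ≡ 2, ν = 4` and compares exponents of `2`
(this is where characteristic zero enters: `2 ∈ Kˣ` has infinite order).

Context. For a CM field `E`, index set `ι = Hom(E, ℂ)` and involution `σ ↦ σ̄ = conj ∘ σ`,
`T̃` (over `K = ℂ`) is the group of complex points of the `ℚ`-torus `{x ∈ E^× | x x̄ ∈ ℚ^×}`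
together with its similitude character; its character group is
`(⊕_σ ℤ ξ_σ ⊕ ℤ ν)/⟨ξ_σ + ξ_σ̄ - ν⟩`, and the lemma says exactly which monomials in the `ξ_σ` are
multiples of `ν`. The `ν = 1` slice is the torus `S(A)` attached by Milne to a simple abelian
variety over a finite field whose endomorphism algebra has a CM field as centre ("the character group of `S(A)` is the quotient of `⊕ ℤ ξ_σ` by the subgroup generated by the
elements `ξ_σ + ξ_ισ`", Milne 1999, §3, p. 19), and the balance condition `n_i = n_{m+i}` is the
hypothesis under which Milne's Lemma 3.8 (op. cit., p. 18) computes torus invariants in a tensor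
algebra; with the similitude factor it describes the invariants of the group `G(A)` of
Milne 1999, Thm. 4.4 (p. 21) on Hodge/Tate monomials. Nothing from those statements is used or
claimed here: this file is the elementary exponent bookkeeping only.

Provenance: written in the speedrun package `HodgeCMPerL` as `HodgeCM/CM/TorusChar.lean`
(cell pub-hodgecm, unit qw8b, gate run 20, 2026-08-18; there over `K = ℂ`), re-homed under the
LEAN-IN-TREE rule, generalised from `ℂ` to any field of characteristic zero.

## References

* J. S. Milne, *Lefschetz classes on abelian varieties*, Duke Math. J. 96 (1999), 639–675,
  §3 (Lemma 3.8 and p. 19), §4 (Def. 4.3, Thm. 4.4).  [bib: Milne1999LefschetzClasses]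
-/

namespace Literature.AlgebraicGeometry.Motives

namespace CMTorusChar

variable {ι : Type*} {K : Type*} [Field K]

/-! ### Half-systems of a fixed-point-free involution -/

/-- A fixed-point-free involution `bar` on a finite set admits a half-system `T`: a subset with
`i ∈ T ↔ bar i ∉ T`, i.e. `ι = T ⊔ bar(T)` (a "CM type" for `bar`). [folklore] -/
theorem exists_halfSystem [Fintype ι] (bar : ι → ι) (hbar : Function.Involutive bar)
    (hfix : ∀ i, bar i ≠ i) : ∃ T : Finset ι, ∀ i, i ∈ T ↔ bar i ∉ T := by
  classical
  let e := Fintype.equivFin ι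
  refine ⟨Finset.univ.filter (fun i => e i < e (bar i)), fun i => ?_⟩
  simp only [Finset.mem_filter, Finset.mem_univ, true_and, hbar i, not_lt]
  have hne : e i ≠ e (bar i) := fun h => hfix i (e.injective h).symm
  exact ⟨le_of_lt, fun h => lt_of_le_of_ne h hne⟩

/-- For a half-system `T` of the involution `bar`, the whole index set is `T ∪ bar(T)`. [folklore] -/
theorem univ_eq_union_map [Fintype ι] [DecidableEq ι] (bar : ι → ι) (hbar : Function.Involutive bar)
    {T : Finset ι} (hT : ∀ i, i ∈ T ↔ bar i ∉ T) :
    (Finset.univ : Finset ι) = T ∪ T.map ⟨bar, hbar.injective⟩ := by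
  ext i
  simp only [Finset.mem_univ, Finset.mem_union, Finset.mem_map, Function.Embedding.coeFn_mk,
    true_iff]
  by_cases hi : i ∈ T
  · exact Or.inl hi
  · right
    refine ⟨bar i, ?_, hbar i⟩
    rw [hT (bar i), hbar i]
    exact hi

/-- A half-system `T` of the involution `bar` is disjoint from its conjugate `bar(T)`. [folklore] -/
theorem disjoint_map (bar : ι → ι) (hbar : Function.Involutive bar) {T : Finset ι}
    (hT : ∀ i, i ∈ T ↔ bar i ∉ T) : Disjoint T (T.map ⟨bar, hbar.injective⟩) := by
  rw [Finset.disjoint_left]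
  intro i hi hi'
  rw [Finset.mem_map] at hi'
  obtain ⟨j, hj, hji⟩ := hi'
  simp only [Function.Embedding.coeFn_mk] at hji
  rw [hT j, hji] at hj
  exact hj hi

/-- Over a half-system, conjugation-balanced exponents sum to half the total:
`Σ_i n_i = 2 Σ_{i ∈ T} n_i`. [folklore] -/
theorem sum_halfSystem [Fintype ι] [DecidableEq ι] (bar : ι → ι) (hbar : Function.Involutive bar)
    {T : Finset ι} (hT : ∀ i, i ∈ T ↔ bar i ∉ T) (n : ι → ℕ) (hbal : ∀ i, n i = n (bar i)) :
    ∑ i, n i = 2 * ∑ i ∈ T, n i := by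
  rw [univ_eq_union_map bar hbar hT, Finset.sum_union (disjoint_map bar hbar hT), Finset.sum_map]
  simp only [Function.Embedding.coeFn_mk]
  rw [Finset.sum_congr rfl (fun i _ => (hbal i).symm)]
  ring

/-! ### The criterion -/

/-- **Balanced ⟹ trivial.** If `n_i = n_ī` for all `i` and `Σ n_i = 2p`, then
`∏ z_i ^ n_i = ν ^ p` at every point of the torus `z_i z_ī = ν`. [folklore] -/
theorem prod_pow_eq_pow_of_balanced [Fintype ι] [DecidableEq ι] (bar : ι → ι)
    (hbar : Function.Involutive bar) (hfix : ∀ i, bar i ≠ i) (n : ι → ℕ) (p : ℕ)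
    (hbal : ∀ i, n i = n (bar i)) (hsum : ∑ i, n i = 2 * p)
    (z : ι → Kˣ) (ν : Kˣ) (hz : ∀ i, z i * z (bar i) = ν) : ∏ i, z i ^ n i = ν ^ p := by
  obtain ⟨T, hT⟩ := exists_halfSystem bar hbar hfix
  have hsumT : ∑ i ∈ T, n i = p := by
    have := sum_halfSystem bar hbar hT n hbal
    omega
  rw [univ_eq_union_map bar hbar hT, Finset.prod_union (disjoint_map bar hbar hT), Finset.prod_map,
    ← Finset.prod_mul_distrib]
  simp only [Function.Embedding.coeFn_mk]
  rw [← hsumT, ← Finset.prod_pow_eq_pow_sum]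
  refine Finset.prod_congr rfl (fun i _ => ?_)
  rw [← hbal i, ← mul_pow, hz i]

/-- In characteristic zero the unit `2 ∈ Kˣ` has infinite order: `2 ^ a = 2 ^ b → a = b`. [folklore] -/
theorem two_pow_injective [CharZero K] {a b : ℕ}
    (h : (Units.mk0 (2 : K) two_ne_zero) ^ a = (Units.mk0 (2 : K) two_ne_zero) ^ b) : a = b := by
  have h' : (2 : K) ^ a = (2 : K) ^ b := by
    simpa using congrArg Units.val h
  have h'' : ((2 ^ a : ℕ) : K) = ((2 ^ b : ℕ) : K) := by
    push_cast
    exact h'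
  exact Nat.pow_right_injective le_rfl (Nat.cast_inj.mp h'')

/-- **Trivial ⟹ balanced.** If `∏ z_i ^ n_i = ν ^ p` on the whole torus `z_i z_ī = ν`
(`K` of characteristic zero), then the exponents are conjugation-balanced and of total degree `2p`.
Test points: `z = (2 at i₀, 2⁻¹ at ī₀, 1 elsewhere), ν = 1`, and `z ≡ 2, ν = 4`. [folklore] -/
theorem balanced_of_prod_pow_eq_pow [Fintype ι] [DecidableEq ι] [CharZero K] (bar : ι → ι)
    (hbar : Function.Involutive bar) (hfix : ∀ i, bar i ≠ i) (n : ι → ℕ) (p : ℕ)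
    (h : ∀ (z : ι → Kˣ) (ν : Kˣ), (∀ i, z i * z (bar i) = ν) → ∏ i, z i ^ n i = ν ^ p) :
    (∀ i, n i = n (bar i)) ∧ ∑ i, n i = 2 * p := by
  set u : Kˣ := Units.mk0 (2 : K) two_ne_zero with hu
  constructor
  · intro i₀
    have hne : i₀ ≠ bar i₀ := fun e => hfix i₀ e.symm
    let z : ι → Kˣ := fun j => if j = i₀ then u else if j = bar i₀ then u⁻¹ else 1
    have hz : ∀ j, z j * z (bar j) = 1 := by
      intro j
      by_cases h1 : j = i₀
      · rw [h1]
        simp [z, hne.symm]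
      · by_cases h2 : j = bar i₀
        · rw [h2, hbar i₀]
          simp [z, hne.symm]
        · have h3 : bar j ≠ i₀ := fun e => h2 (by rw [← e, hbar j])
          have h4 : bar j ≠ bar i₀ := fun e => h1 (hbar.injective e)
          simp [z, h1, h2, h3, h4]
    have hz0 : z i₀ = u := by simp [z]
    have hz1 : z (bar i₀) = u⁻¹ := by simp [z, hne.symm]
    have hprod := h z 1 hz
    rw [one_pow, Finset.prod_eq_mul i₀ (bar i₀) hne (fun j _ hj => by simp [z, hj.1, hj.2])
        (by simp) (by simp)] at hprod
    simp only [hz0, hz1, inv_pow, mul_inv_eq_one] at hprod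
    exact two_pow_injective hprod
  · have hz : ∀ j, (fun _ : ι => u) j * (fun _ : ι => u) (bar j) = u * u := fun _ => rfl
    have hprod := h (fun _ => u) (u * u) hz
    rw [Finset.prod_pow_eq_pow_sum, ← pow_two, ← pow_mul] at hprod
    exact two_pow_injective hprod

/-- **The criterion.** On the torus `{z_i z_ī = ν} ⊂ (Kˣ)^ι × Kˣ` (`K` of characteristic zero,
`bar` a fixed-point-free involution of the finite index set) the monomial `∏ z_i ^ n_i` is the
character `ν ^ p` iff the exponents are conjugation-balanced (`n_i = n_ī`) and of total degree
`2p`. The balance condition is the one under which Milne computes torus invariants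
(Milne 1999, Lemma 3.8 and p. 19, for the `ν = 1` torus `S(A)`). [folklore] -/
theorem prod_pow_eq_pow_iff_balanced [Fintype ι] [DecidableEq ι] [CharZero K] (bar : ι → ι)
    (hbar : Function.Involutive bar) (hfix : ∀ i, bar i ≠ i) (n : ι → ℕ) (p : ℕ) :
    (∀ (z : ι → Kˣ) (ν : Kˣ), (∀ i, z i * z (bar i) = ν) → ∏ i, z i ^ n i = ν ^ p) ↔
      (∀ i, n i = n (bar i)) ∧ ∑ i, n i = 2 * p :=
  ⟨balanced_of_prod_pow_eq_pow bar hbar hfix n p,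
    fun hb z ν hz => prod_pow_eq_pow_of_balanced bar hbar hfix n p hb.1 hb.2 z ν hz⟩

end CMTorusChar

end Literature.AlgebraicGeometry.Motives
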